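import Literature.Geometry.Lorentzian.KerrDomainOfDependence
import Literature.Geometry.Lorentzian.KerrSchildWaveCauchyReduction
import HarnessLib

/-!
# Assembly of the Kerr–Schild wave Cauchy problem from slab solutions: time reversal, dilations,
# uniqueness and domain of dependence on generalised Kerr–Schild backgrounds over `ℝ⁴`

(family `gr`; namespace `Literature.Geometry.Lorentzian.KerrSchild`; proved infrastructure for
the discharge of the named fact `KerrSchild.waveCauchyProblem` of
`KerrSchildWaveCauchyProblem.lean`; this file introduces no named fact and no `sorry`)

The named fact `KerrSchild.waveCauchyProblem` asks, for every generalised Kerr–Schild background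
`B` on `ℝ⁴` (`g⁻¹ = η⁻¹ − φ ℓ♯ ⊗ ℓ♯`, `KerrSchild.Background`) and all data `ψ₀, ψ₁ ∈ C_c^∞(ℝ³)`, for
a global `u ∈ C^∞(ℝ⁴)` with `∑_μ ∂_μ (g^{μν} ∂_ν u) = 0`, coordinate Cauchy data `(ψ₀, ψ₁)` on
`{t = 0}`, and `u = 0` outside the Minkowski domain of influence of the support of the data
(Bär–Ginoux–Pfäffle 2007, Thm. 3.2.11, in the chart). `KerrSchildWaveCauchyReduction.lean` reduces it
to *tame* backgrounds. The analytic core of any discharge is an **existence theorem for smooth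
solutions on time slabs** (energy method: Hörmander 1997, §6.3; Alinhac 2009, Thm. 7.11;
Friedrichs 1954); everything between such a core and the fact as stated is proved here, once and
independently of the existence scheme:

* `KerrSchild.waveOperator_congr_fun`, `KerrSchild.waveOperator_sub` — locality and linearity of
  the divergence-form operator `□_G u = ∑_μ ∂_μ(∑_ν G^{μν} ∂_ν u)` in the function;
* `KerrSchild.timeReflect`, `KerrSchild.waveOperator_comp_timeReflect`,
  `KerrSchild.Background.timeReverse`, `KerrSchild.Background.waveOperator_timeReverse`,
  `KerrSchild.Background.IsTame.timeReverse` — **time reversal** `J(t, y) = (−t, y)`: the class of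
  (tame) backgrounds is closed under it (profile `φ ∘ J`, null vector `−J ∘ ℓ♯ ∘ J`, coefficients
  `ε_μ ε_ν g^{μν} ∘ J`) and `□_{B.timeReverse}(u ∘ J) = (□_B u) ∘ J`;
* `KerrSchild.waveOperator_comp_smul`, `KerrSchild.Background.dilate`,
  `KerrSchild.Background.waveOperator_dilate` — **dilations** `(t, y) ↦ (ct, cy)`:
  `□_{B.dilate c}(u(c ·)) = c² (□_B u)(c ·)`;
* `KerrSchild.Background.coneWeight`, `…coneWeight_flux` — the weight
  `χ_slab(t) · χ((A − t)² − ‖y − c‖²)` of a truncated backward coordinate cone (the weight of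
  `KerrDomainOfDependence.lean` without its horizon factor) decreases along the energy flow of every
  background on the slab `{0 ≤ t ≤ T}` (`Kerr.coneFactor_flux`: the light cones of
  `g = η + φ ℓ ⊗ ℓ`, `φ ≥ 0`, lie inside the coordinate cones; dominant energy condition);
* `KerrSchild.Background.eq_zero_of_data_ball`, `…_of_nonpos`, `…_abs` — **domain of dependence
  of the initial slice, pointwise form**: a `C²` solution on a set `U` whose Cauchy data `(u, du)`
  vanish on the leaf points `(0, y)`, `dist(y, x⃗) < R`, `R > |x⁰|`, vanishes with its differential
  at `x` (Hawking–Ellis 1973, §4.3, conservation theorem, through the weighted form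
  `KerrSchild.Background.fderiv_eq_zero_of_weight` of `KerrSchildLocalEnergy.lean`; backward in time
  by time reversal);
* `E4.fderiv_eq_zero_of_slice` — coordinate data `(u|₀ ≡ 0 near y, ∂_t u(0, y) = 0)` give
  `du(0, y) = 0`;
* `KerrSchild.Background.eq_of_data_eq` — **uniqueness on time slabs**: two `C²` solutions on
  `{|t| < S}` with the same coordinate Cauchy data coincide on the slab (Bär–Ginoux–Pfäffle 2007,
  Cor. 3.2.4 in the chart; the margin of the slab cutoff is removed by a dilation);
* `KerrSchild.Background.eq_zero_of_forall_lt_dist` — **the support clause of the fact** for every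
  global `C²` solution with data `(ψ₀, ψ₁)`: `u(x) = 0` whenever `|x⁰| < dist(x⃗, y)` for all
  `y ∈ supp ψ₀ ∪ supp ψ₁`;
* `KerrSchild.waveCauchyProblem_of_slabSolutions` — **the assembly**: if on every tame background
  all `C_c^∞` data admit, for every `T > 0`, a solution `C^∞` on the open slab `{|t| < T}` with the
  data, then `KerrSchild.waveCauchyProblem` holds (slab solutions of half-widths `n + 3` agree on
  `{|t| < n + 1}` by uniqueness and glue to a global smooth solution by locality; support clause;
  `waveCauchyProblem_of_tame`); `KerrSchild.waveCauchyProblem_of_globalSolutions` — the same from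
  global smooth solutions without support information; `KerrSchild.waveCauchyProblem_of_slabSolutions_nat`
  — the same from slab solutions of class `C^{k+2}` for every `k` separately (regularity by
  uniqueness across levels, `contDiffAt_infty`).

So the remaining proof obligation of `KerrSchild.waveCauchyProblem` is exactly the hypothesis of
`waveCauchyProblem_of_slabSolutions`: smooth solutions on open time slabs of tame backgrounds
(coefficients equal to `η` outside a bounded cylinder of the slab, hence with all derivatives
bounded), with prescribed `C_c^∞` coordinate data and no support condition. It is deliberately not
vendored as a named fact (it is the apex of the fact's own proof, not a distinct published result;
D-0026), exactly as in `KerrSchildWaveCauchyReduction.lean`.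

## Design choices / what is not here

* Solutions are functions `E4 → ℝ` with pointwise `ContDiffAt` hypotheses on explicit sets, as in
  `KerrSchildLocalEnergy.lean`; no Sobolev spaces appear (they belong to the existence core).
* The pointwise domain-of-dependence statements carry the margins (`−2`, `+2`) of the slab cutoff
  `Kerr.timeSlabCutoff` in their container hypotheses; the uniqueness theorem and the support
  clause, which are the statements consumed by the assembly, are sharp.
* Not here: gluing of a forward solution on `{0 ≤ t < T}` with a backward one (which would need
  the matching of all time derivatives on `{t = 0}` through the equation) — an existence scheme run
  on two-sided slabs, or on forward slabs of `B` and of `B.timeReverse` followed by such a matching,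
  feeds `waveCauchyProblem_of_slabSolutions`; the causal (`J^g`) form of the support clause.

## Mathlib / tree search

Tree: `KerrSchild.waveOperator`, `Background`, `waveCauchyProblem` (`KerrSchildWaveCauchyProblem`),
`waveCauchyProblem_of_tame`, `IsTame` (`KerrSchildWaveCauchyReduction`),
`Background.fderiv_eq_zero_of_weight` (`KerrSchildLocalEnergy`), `Kerr.coneFn`,
`Kerr.timeSlabCutoff`, `Kerr.coneFactor_flux`, `Kerr.vanish_of_data_ball` (the Kerr-exterior
version with a horizon factor, `KerrDomainOfDependence`), `E4.fderiv_comp_ofTimeSpace`,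
`E4.hasDerivAt_ofTimeSpace_left`, `Kerr.eq_sum_basisVector`; no time reversal / dilation of
backgrounds and no background-level uniqueness existed (`lean search 'timeReverse|uniqueness.*Background'`).
Mathlib: `ContinuousLinearEquiv.comp_right_fderiv`, `fderiv_comp_smul`,
`constant_of_has_deriv_right_zero`, `IsClosed.exists_infDist_eq_dist`, `Nat.ceil`.

## References

* C. Bär, N. Ginoux, F. Pfäffle, *Wave equations on Lorentzian manifolds and quantization*, EMS
  2007 (arXiv:0806.1036): Thm. 3.2.11 and its proof from Prop. 3.2.6, Lemmas 3.2.7–3.2.8, and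
  Cor. 3.2.4 (= arXiv Ch. 3, Sect. 2, Thm. 2.9, Cor. 2.4) (key `BarGinouxPfaffle2007`).
* S. W. Hawking, G. F. R. Ellis, *The large scale structure of space-time*, CUP 1973, §4.3,
  Lemma 4.3.1 and the conservation theorem (key `HawkingEllis1973CUP`).
* L. Hörmander, *Lectures on nonlinear hyperbolic differential equations*, Springer 1997, §6.3,
  pp. 106–108 (key `Hormander1997`).
* R. P. Kerr, A. Schild, 1965, §2 (key `KerrSchild1965`).
-/

noncomputable section

open Set Filter Metric
open scoped Topology ContDiff

namespace Literature.Geometry.Lorentzian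

namespace KerrSchild

/-! ### Locality and linearity of the divergence-form wave operator in the function -/

/-- **The wave operator is local in the function**: two functions which agree near `x` have the
same wave operator at `x`, for every coefficient field. [folklore] -/
theorem waveOperator_congr_fun {G : E4 → Fin 4 → Fin 4 → ℝ} {u v : E4 → ℝ} {x : E4}
    (h : u =ᶠ[𝓝 x] v) : waveOperator G u x = waveOperator G v x := by
  have h' : ∀ᶠ y in 𝓝 x, u =ᶠ[𝓝 y] v := h.eventually_nhds
  unfold waveOperator
  refine Finset.sum_congr rfl fun μ _ ↦ ?_
  have hμ : (fun y ↦ ∑ ν, G y μ ν * fderiv ℝ u y (E4.basisVector ν)) =ᶠ[𝓝 x]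
      fun y ↦ ∑ ν, G y μ ν * fderiv ℝ v y (E4.basisVector ν) := by
    filter_upwards [h'] with y hy
    simp only [hy.fderiv_eq]
  rw [hμ.fderiv_eq]

/-- **The wave operator is linear in the function (difference form)**: at a point near which
`u` and `v` are `C²` and the coefficients are differentiable,
`□_G (u − v) = □_G u − □_G v`. [folklore] -/
theorem waveOperator_sub {G : E4 → Fin 4 → Fin 4 → ℝ} {u v : E4 → ℝ} {x : E4}
    (hG : ∀ μ ν, DifferentiableAt ℝ (fun y ↦ G y μ ν) x)
    (hu : ContDiffAt ℝ 2 u x) (hv : ContDiffAt ℝ 2 v x) :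
    waveOperator G (u - v) x = waveOperator G u x - waveOperator G v x := by
  -- near `x`, both functions are differentiable
  have hu1 : ∀ᶠ y in 𝓝 x, DifferentiableAt ℝ u y := by
    filter_upwards [hu.eventually (by simp)] with y hy
    exact hy.differentiableAt (by simp)
  have hv1 : ∀ᶠ y in 𝓝 x, DifferentiableAt ℝ v y := by
    filter_upwards [hv.eventually (by simp)] with y hy
    exact hy.differentiableAt (by simp)
  -- the first derivatives along the frame are differentiable at `x`
  have h2 : ((1 : ℕ∞) + 1 : ℕ∞) = (2 : ℕ∞) := by norm_num
  have hdu : ∀ ν, DifferentiableAt ℝ (fun y ↦ fderiv ℝ u y (E4.basisVector ν)) x := fun ν ↦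
    ((hu.fderiv_right (m := 1) (by exact_mod_cast h2.le)).clm_apply
      contDiffAt_const).differentiableAt (by simp)
  have hdv : ∀ ν, DifferentiableAt ℝ (fun y ↦ fderiv ℝ v y (E4.basisVector ν)) x := fun ν ↦
    ((hv.fderiv_right (m := 1) (by exact_mod_cast h2.le)).clm_apply
      contDiffAt_const).differentiableAt (by simp)
  unfold waveOperator
  rw [← Finset.sum_sub_distrib]
  refine Finset.sum_congr rfl fun μ _ ↦ ?_
  have hin : (fun y ↦ ∑ ν, G y μ ν * fderiv ℝ (u - v) y (E4.basisVector ν)) =ᶠ[𝓝 x]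
      fun y ↦ (∑ ν, G y μ ν * fderiv ℝ u y (E4.basisVector ν)) -
        ∑ ν, G y μ ν * fderiv ℝ v y (E4.basisVector ν) := by
    filter_upwards [hu1, hv1] with y hyu hyv
    rw [fderiv_sub hyu hyv, ← Finset.sum_sub_distrib]
    refine Finset.sum_congr rfl fun ν _ ↦ ?_
    rw [sub_apply]
    ring
  have hA : DifferentiableAt ℝ (fun y ↦ ∑ ν, G y μ ν * fderiv ℝ u y (E4.basisVector ν)) x :=
    DifferentiableAt.fun_sum fun ν _ ↦ (hG μ ν).fun_mul (hdu ν)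
  have hB : DifferentiableAt ℝ (fun y ↦ ∑ ν, G y μ ν * fderiv ℝ v y (E4.basisVector ν)) x :=
    DifferentiableAt.fun_sum fun ν _ ↦ (hG μ ν).fun_mul (hdv ν)
  rw [hin.fderiv_eq, fderiv_fun_sub hA hB, sub_apply]

/-! ### Time reflection of `ℝ⁴` -/

/-- The sign `ε_μ` of the time reflection on the `μ`-th coordinate: `−1` for `μ = 0`, `1`
otherwise. [folklore] -/
def timeSign (μ : Fin 4) : ℝ := if μ = 0 then -1 else 1

/-- `ε₀ = −1`. [folklore] -/
@[simp] theorem timeSign_zero : timeSign 0 = -1 := rfl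

/-- `ε_{i+1} = 1`. [folklore] -/
@[simp] theorem timeSign_succ (i : Fin 3) : timeSign i.succ = 1 := by
  simp [timeSign, Fin.succ_ne_zero]

/-- `ε_μ² = 1`. [folklore] -/
theorem timeSign_mul_self (μ : Fin 4) : timeSign μ * timeSign μ = 1 := by
  unfold timeSign; split_ifs <;> norm_num

/-- `ε_μ ≠ 0`. [folklore] -/
theorem timeSign_ne_zero (μ : Fin 4) : timeSign μ ≠ 0 := by
  unfold timeSign; split_ifs <;> norm_num

/-- The time reflection as a continuous linear map: `v ↦ v − 2 v⁰ ∂₀`. [folklore] -/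
def timeReflectAux : E4 →L[ℝ] E4 :=
  ContinuousLinearMap.id ℝ E4 -
    (2 : ℝ) • (EuclideanSpace.proj (𝕜 := ℝ) (0 : Fin 4)).smulRight (E4.basisVector 0)

/-- Components of the time reflection: `(Jv)^μ = ε_μ v^μ`. [folklore] -/
theorem timeReflectAux_apply (v : E4) (μ : Fin 4) : timeReflectAux v μ = timeSign μ * v μ := by
  simp only [timeReflectAux, sub_apply, smul_apply, ContinuousLinearMap.coe_id', id_eq,
    ContinuousLinearMap.smulRight_apply, PiLp.proj_apply]
  rw [PiLp.sub_apply, PiLp.smul_apply, PiLp.smul_apply, PiLp.single_apply]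
  unfold timeSign
  split_ifs with h
  · subst h; simp; ring
  · simp

/-- The time reflection is an involution. [folklore] -/
theorem timeReflectAux_timeReflectAux (v : E4) : timeReflectAux (timeReflectAux v) = v := by
  ext μ
  rw [timeReflectAux_apply, timeReflectAux_apply, ← mul_assoc, timeSign_mul_self, one_mul]

/-- **The time reflection** `J(t, y⃗) = (−t, y⃗)` of `ℝ⁴`, as a continuous linear automorphism
(an involution). [folklore] -/
def timeReflect : E4 ≃L[ℝ] E4 :=
  ContinuousLinearEquiv.equivOfInverse timeReflectAux timeReflectAux
    timeReflectAux_timeReflectAux timeReflectAux_timeReflectAux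

/-- Components of the time reflection: `(Jv)^μ = ε_μ v^μ`. [folklore] -/
theorem timeReflect_apply (v : E4) (μ : Fin 4) : timeReflect v μ = timeSign μ * v μ :=
  timeReflectAux_apply v μ

/-- `(Jv)⁰ = −v⁰`. [folklore] -/
@[simp] theorem timeReflect_apply_zero (v : E4) : timeReflect v 0 = -v 0 := by
  rw [timeReflect_apply, timeSign_zero]; ring

/-- `(Jv)ⁱ = vⁱ` for the spatial components. [folklore] -/
@[simp] theorem timeReflect_apply_succ (v : E4) (i : Fin 3) :
    timeReflect v i.succ = v i.succ := by
  rw [timeReflect_apply, timeSign_succ, one_mul]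

/-- `J ∘ J = id`. [folklore] -/
@[simp] theorem timeReflect_timeReflect (v : E4) : timeReflect (timeReflect v) = v :=
  timeReflectAux_timeReflectAux v

/-- `J ∂_μ = ε_μ ∂_μ`. [folklore] -/
theorem timeReflect_basisVector (μ : Fin 4) :
    timeReflect (E4.basisVector μ) = timeSign μ • E4.basisVector μ := by
  ext ν
  rw [timeReflect_apply, PiLp.smul_apply, smul_eq_mul, PiLp.single_apply]
  split_ifs with h
  · subst h; rfl
  · simp

/-- The time reflection preserves the spatial part. [folklore] -/
@[simp] theorem spatial_timeReflect (v : E4) : E4.spatial (timeReflect v) = E4.spatial v := by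
  ext i
  simp [E4.spatial_apply]

/-- `J(t, y) = (−t, y)`. [folklore] -/
@[simp] theorem timeReflect_ofTimeSpace (t : ℝ) (y : E3) :
    timeReflect (E4.ofTimeSpace t y) = E4.ofTimeSpace (-t) y := by
  ext μ
  refine Fin.cases ?_ (fun i ↦ ?_) μ
  · simp
  · simp

/-- `|(Jv)⁰| = |v⁰|`. [folklore] -/
theorem abs_timeReflect_apply_zero (v : E4) : |timeReflect v 0| = |v 0| := by
  rw [timeReflect_apply_zero, abs_neg]

/-- **Chain rule under the time reflection**: `d(u ∘ J)(x) = du(Jx) ∘ J` (no differentiability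
hypothesis: both sides vanish when `u` is not differentiable at `Jx`). [folklore] -/
theorem fderiv_comp_timeReflect (u : E4 → ℝ) (x : E4) :
    fderiv ℝ (u ∘ timeReflect) x = (fderiv ℝ u (timeReflect x)).comp (timeReflect : E4 →L[ℝ] E4) :=
  timeReflect.comp_right_fderiv

/-- `∂_μ (u ∘ J)(x) = ε_μ (∂_μ u)(Jx)`. [folklore] -/
theorem fderiv_comp_timeReflect_basisVector (u : E4 → ℝ) (x : E4) (μ : Fin 4) :
    fderiv ℝ (u ∘ timeReflect) x (E4.basisVector μ) =
      timeSign μ * fderiv ℝ u (timeReflect x) (E4.basisVector μ) := by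
  rw [fderiv_comp_timeReflect, ContinuousLinearMap.comp_apply, ContinuousLinearEquiv.coe_coe,
    timeReflect_basisVector, map_smul, smul_eq_mul]

/-- `fderiv` of a constant multiple, without differentiability hypothesis, for a nonzero
constant. [folklore] -/
theorem fderiv_const_mul_of_ne_zero {f : E4 → ℝ} {c : ℝ} (hc : c ≠ 0) (x : E4) :
    fderiv ℝ (fun y ↦ c * f y) x = c • fderiv ℝ f x := by
  by_cases hf : DifferentiableAt ℝ f x
  · exact fderiv_const_mul hf c
  · have hcf : ¬ DifferentiableAt ℝ (fun y ↦ c * f y) x := by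
      intro h
      apply hf
      have : f = fun y ↦ c⁻¹ * (c * f y) := by
        funext y; field_simp
      rw [this]
      exact h.const_mul _
    rw [fderiv_zero_of_not_differentiableAt hf, fderiv_zero_of_not_differentiableAt hcf,
      smul_zero]

/-- **The wave operator under time reflection.** For every coefficient field `G` and function
`u`, the wave operator of the reflected coefficients `ε_μ ε_ν G^{μν} ∘ J` applied to `u ∘ J` at `x`
is the wave operator of `G` applied to `u` at `Jx`. [folklore] -/
theorem waveOperator_comp_timeReflect (G : E4 → Fin 4 → Fin 4 → ℝ) (u : E4 → ℝ) (x : E4) :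
    waveOperator (fun y μ ν ↦ timeSign μ * timeSign ν * G (timeReflect y) μ ν)
      (u ∘ timeReflect) x = waveOperator G u (timeReflect x) := by
  unfold waveOperator
  refine Finset.sum_congr rfl fun μ _ ↦ ?_
  set F : E4 → ℝ := fun z ↦ ∑ ν, G z μ ν * fderiv ℝ u z (E4.basisVector ν) with hF
  have hin : (fun y ↦ ∑ ν, timeSign μ * timeSign ν * G (timeReflect y) μ ν *
      fderiv ℝ (u ∘ timeReflect) y (E4.basisVector ν)) =
      fun y ↦ timeSign μ * (F ∘ timeReflect) y := by
    funext y
    simp only [hF, Function.comp_apply, Finset.mul_sum]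
    refine Finset.sum_congr rfl fun ν _ ↦ ?_
    rw [fderiv_comp_timeReflect_basisVector]
    have := timeSign_mul_self ν
    calc timeSign μ * timeSign ν * G (timeReflect y) μ ν *
          (timeSign ν * fderiv ℝ u (timeReflect y) (E4.basisVector ν))
        = timeSign μ * (timeSign ν * timeSign ν) * (G (timeReflect y) μ ν *
          fderiv ℝ u (timeReflect y) (E4.basisVector ν)) := by ring
      _ = _ := by rw [this, mul_one]
  rw [hin, fderiv_const_mul_of_ne_zero (timeSign_ne_zero μ), smul_apply,
    fderiv_comp_timeReflect_basisVector, smul_eq_mul, ← mul_assoc, timeSign_mul_self, one_mul]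

/-- The time reflection is an `η`-isometry. [folklore] -/
@[simp] theorem bilin_timeReflect (v w : E4) :
    Minkowski.bilin (timeReflect v) (timeReflect w) = Minkowski.bilin v w := by
  simp [Minkowski.bilin_apply]

/-- `ε_μ ε_ν η^{μν} = η^{μν}` (`η` is diagonal). [folklore] -/
theorem timeSign_mul_etaComp (μ ν : Fin 4) :
    timeSign μ * timeSign ν * Kerr.etaComp μ ν = Kerr.etaComp μ ν := by
  by_cases h : μ = ν
  · subst h; rw [timeSign_mul_self, one_mul]
  · simp [Kerr.etaComp, h]

/-- **The Kerr–Schild inverse metric under time reflection**: the coefficients of the profile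
`φ ∘ J` and the null vector `−J ∘ l ∘ J` are `ε_μ ε_ν g^{μν} ∘ J`. [cite: KerrSchild1965, §2] -/
theorem inverseMetric_timeReflect (φ : E4 → ℝ) (l : E4 → E4) (x : E4) (μ ν : Fin 4) :
    inverseMetric (fun y ↦ φ (timeReflect y)) (fun y ↦ -timeReflect (l (timeReflect y))) x μ ν =
      timeSign μ * timeSign ν * inverseMetric φ l (timeReflect x) μ ν := by
  simp only [inverseMetric, PiLp.neg_apply, timeReflect_apply]
  rw [mul_sub, timeSign_mul_etaComp]
  ring

/-! ### Spacetime dilations -/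

/-- **The wave operator under the spacetime dilation `y ↦ c y`**: for every coefficient field `G`
and function `u`, `□_{G(c ·)} (u(c ·)) (x) = c² (□_G u)(c x)`. [folklore] -/
theorem waveOperator_comp_smul (G : E4 → Fin 4 → Fin 4 → ℝ) (u : E4 → ℝ) (c : ℝ) (x : E4) :
    waveOperator (fun y ↦ G (c • y)) (fun y ↦ u (c • y)) x = c ^ 2 * waveOperator G u (c • x) := by
  unfold waveOperator
  rw [Finset.mul_sum]
  refine Finset.sum_congr rfl fun μ _ ↦ ?_
  set F : E4 → ℝ := fun z ↦ ∑ ν, G z μ ν * fderiv ℝ u z (E4.basisVector ν) with hF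
  have hin : (fun y ↦ ∑ ν, G (c • y) μ ν * fderiv ℝ (fun y ↦ u (c • y)) y (E4.basisVector ν)) =
      fun y ↦ c * F (c • y) := by
    funext y
    simp only [hF, Finset.mul_sum]
    refine Finset.sum_congr rfl fun ν _ ↦ ?_
    rw [fderiv_comp_smul c, smul_apply, smul_eq_mul]
    ring
  rw [hin]
  by_cases hc : c = 0
  · subst hc
    simp
  · rw [fderiv_const_mul_of_ne_zero hc, smul_apply, smul_eq_mul]
    rw [show (fun y ↦ F (c • y)) = (F <| c • ·) from rfl, fderiv_comp_smul c, smul_apply,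
      smul_eq_mul]
    ring

/-- `c (t, y) = (c t, c y)`. [folklore] -/
theorem _root_.Literature.Geometry.Lorentzian.E4.smul_ofTimeSpace (c t : ℝ) (y : E3) :
    c • E4.ofTimeSpace t y = E4.ofTimeSpace (c * t) (c • y) := by
  ext μ
  refine Fin.cases ?_ (fun i ↦ ?_) μ
  · simp
  · simp

namespace Background

/-! ### Time reversal of a background -/

/-- **The time reversal of a generalised Kerr–Schild background**: profile `φ ∘ J`, null vector
`−J ∘ l ∘ J` (so that `ℓ(∂_t) = 1` is preserved), same bound; its inverse metric is
`ε_μ ε_ν g^{μν} ∘ J` (`timeReverse_inverseMetric`). [cite: KerrSchild1965, §2] -/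
def timeReverse (B : Background) : Background where
  φ x := B.φ (timeReflect x)
  l x := -timeReflect (B.l (timeReflect x))
  bound := B.bound
  φ_nonneg x := B.φ_nonneg _
  φ_le x := B.φ_le _
  null x hx := by
    have h := B.null (timeReflect x) hx
    simpa only [map_neg, neg_apply, neg_neg, bilin_timeReflect] using h
  normalised x hx := by
    have h := B.normalised (timeReflect x) hx
    rw [Minkowski.bilin_symm, Minkowski.bilin_basisVector_zero_left] at h ⊢
    rw [PiLp.neg_apply, timeReflect_apply_zero, neg_neg]
    exact h
  contDiff_inverseMetric μ ν := by
    have h : (fun x ↦ KerrSchild.inverseMetric (fun x ↦ B.φ (timeReflect x))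
        (fun x ↦ -timeReflect (B.l (timeReflect x))) x μ ν) =
        fun x ↦ timeSign μ * timeSign ν * B.inverseMetric (timeReflect x) μ ν :=
      funext fun x ↦ inverseMetric_timeReflect B.φ B.l x μ ν
    rw [h]
    exact contDiff_const.mul
      ((B.contDiff_inverseMetric μ ν).comp (timeReflect : E4 ≃L[ℝ] E4).contDiff)

/-- The inverse metric of the time-reversed background: `ε_μ ε_ν g^{μν}(Jx)`.
[cite: KerrSchild1965, §2] -/
theorem timeReverse_inverseMetric (B : Background) (x : E4) (μ ν : Fin 4) :
    B.timeReverse.inverseMetric x μ ν =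
      timeSign μ * timeSign ν * B.inverseMetric (timeReflect x) μ ν :=
  inverseMetric_timeReflect B.φ B.l x μ ν

/-- **The wave equation is invariant under time reversal**: the wave operator of the
time-reversed background on `u ∘ J` at `x` is the wave operator of `B` on `u` at `Jx`.
[cite: KerrSchild1965, §2] -/
theorem waveOperator_timeReverse (B : Background) (u : E4 → ℝ) (x : E4) :
    waveOperator B.timeReverse.inverseMetric (u ∘ timeReflect) x =
      waveOperator B.inverseMetric u (timeReflect x) := by
  have h : B.timeReverse.inverseMetric =
      fun y μ ν ↦ timeSign μ * timeSign ν * B.inverseMetric (timeReflect y) μ ν := by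
    funext y μ ν; exact B.timeReverse_inverseMetric y μ ν
  rw [h]
  exact waveOperator_comp_timeReflect B.inverseMetric u x

/-- The time reversal of a tame background is tame. [cite: Hormander1997, §6.3 (6.3.15)] -/
theorem IsTame.timeReverse {B : Background} (hB : B.IsTame) : B.timeReverse.IsTame := by
  intro T
  obtain ⟨ρ, hρ⟩ := hB T
  refine ⟨ρ, fun x hT hx ↦ ?_⟩
  show B.φ (timeReflect x) = 0
  exact hρ (timeReflect x) (by rwa [abs_timeReflect_apply_zero]) (by rwa [spatial_timeReflect])

/-! ### Dilation of a background -/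

/-- **The dilation of a generalised Kerr–Schild background** by a factor `c`: profile `φ(c ·)`,
null vector `l(c ·)`, same bound; its inverse metric is `g^{μν}(c ·)`. The class of backgrounds,
the wave equation and the coordinate Cauchy data are invariant under the dilations
`(t, y) ↦ (ct, cy)` of `ℝ⁴`. [cite: KerrSchild1965, §2] -/
def dilate (B : Background) (c : ℝ) : Background where
  φ x := B.φ (c • x)
  l x := B.l (c • x)
  bound := B.bound
  φ_nonneg _ := B.φ_nonneg _
  φ_le _ := B.φ_le _
  null _ hx := B.null _ hx
  normalised _ hx := B.normalised _ hx
  contDiff_inverseMetric μ ν := (B.contDiff_inverseMetric μ ν).comp (contDiff_id.const_smul c)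

/-- The inverse metric of the dilated background is `g^{μν}(c ·)`. [cite: KerrSchild1965, §2] -/
theorem dilate_inverseMetric (B : Background) (c : ℝ) :
    (B.dilate c).inverseMetric = fun x ↦ B.inverseMetric (c • x) := rfl

/-- **The wave equation is invariant under dilations**:
`□_{B.dilate c} (u(c ·)) (x) = c² (□_B u)(cx)`. [cite: KerrSchild1965, §2] -/
theorem waveOperator_dilate (B : Background) (u : E4 → ℝ) (c : ℝ) (x : E4) :
    waveOperator (B.dilate c).inverseMetric (fun y ↦ u (c • y)) x =
      c ^ 2 * waveOperator B.inverseMetric u (c • x) := by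
  rw [dilate_inverseMetric]
  exact waveOperator_comp_smul B.inverseMetric u c x

/-! ### The slab–cone weight -/

/-- **The weight** `W(y) = timeSlabCutoff(y⁰) · χ((A − y⁰)² − ‖y⃗ − c‖²)`: a smoothed indicator of
the solid backward coordinate cone `{‖y⃗ − c‖ < A − y⁰}` over the times `−2 < y⁰ < A`
(`Kerr.timeSlabCutoff`, `Kerr.coneFn` of `KerrDomainOfDependence.lean`, without the horizon factor
used there). Hawking–Ellis 1973, §4.3 (the region `𝒰` of Lemma 4.3.1).
[cite: HawkingEllis1973CUP, §4.3 Lemma 4.3.1] -/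
def coneWeight (T A : ℝ) (c : E3) (x : E4) : ℝ :=
  Kerr.timeSlabCutoff T A (x 0) * Real.smoothTransition (Kerr.coneFn A c x)

/-- `W ≥ 0`. [folklore] -/
theorem coneWeight_nonneg (T A : ℝ) (c : E3) (x : E4) : 0 ≤ coneWeight T A c x :=
  mul_nonneg (Kerr.timeSlabCutoff_nonneg _ _ _) (Real.smoothTransition.nonneg _)

/-- `W` is smooth. [folklore] -/
theorem contDiff_coneWeight (T A : ℝ) (c : E3) {n : ℕ∞} : ContDiff ℝ n (coneWeight T A c) :=
  ((Kerr.contDiff_timeSlabCutoff T A).comp contDiff_apply_zero).mul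
    (Real.smoothTransition.contDiff.comp (Kerr.contDiff_coneFn A c))

/-- **Where the weight is nonzero**: `−2 < y⁰ < A` and `‖y⃗ − c‖ < A − y⁰`. [folklore] -/
theorem mem_of_coneWeight_ne_zero {T A : ℝ} {c : E3} (hTA : T < A) {x : E4}
    (hx : coneWeight T A c x ≠ 0) : (-2 < x 0 ∧ x 0 < A) ∧ ‖E4.spatial x - c‖ < A - x 0 := by
  have h1 : Kerr.timeSlabCutoff T A (x 0) ≠ 0 := fun h ↦ hx (by simp [coneWeight, h])
  have h2 : Real.smoothTransition (Kerr.coneFn A c x) ≠ 0 := fun h ↦ hx (by simp [coneWeight, h])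
  have ht := Kerr.lt_of_timeSlabCutoff_ne_zero hTA h1
  refine ⟨ht, ?_⟩
  have hcone : 0 < Kerr.coneFn A c x := by
    by_contra h
    exact h2 (Real.smoothTransition.zero_of_nonpos (not_lt.mp h))
  have hAx : 0 ≤ A - x 0 := by linarith [ht.2]
  refine lt_of_pow_lt_pow_left₀ 2 hAx ?_
  have : 0 < (A - x 0) ^ 2 - ‖E4.spatial x - c‖ ^ 2 := hcone
  linarith

/-- **The support set** `[−2, A] × B̄(c, A + 2)` of the weight, a compact subset of `ℝ⁴`.
[folklore] -/
def coneSet (A : ℝ) (c : E3) : Set E4 :=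
  (fun p : ℝ × E3 ↦ E4.ofTimeSpace p.1 p.2) '' (Icc (-2 : ℝ) A ×ˢ closedBall c (A + 2))

/-- The support set is compact. [folklore] -/
theorem isCompact_coneSet (A : ℝ) (c : E3) : IsCompact (coneSet A c) :=
  (isCompact_Icc.prod (isCompact_closedBall c (A + 2))).image E4.continuous_ofTimeSpace_uncurry

/-- `{W ≠ 0}` lies in the support set. [folklore] -/
theorem mem_coneSet_of_coneWeight_ne_zero {T A : ℝ} {c : E3} (hTA : T < A) {x : E4}
    (hx : coneWeight T A c x ≠ 0) : x ∈ coneSet A c := by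
  obtain ⟨⟨ht1, ht2⟩, hcone⟩ := mem_of_coneWeight_ne_zero hTA hx
  refine ⟨((x 0), E4.spatial x), ⟨⟨ht1.le, ht2.le⟩, ?_⟩, E4.ofTimeSpace_time_spatial x⟩
  rw [mem_closedBall, dist_eq_norm]
  linarith

/-- A set containing all points `z` with `−2 ≤ z⁰ ≤ A` and `dist(z⃗, c) ≤ A + 2` contains the
support set. [folklore] -/
theorem coneSet_subset {A : ℝ} {c : E3} {U : Set E4}
    (hU : ∀ z : E4, -2 ≤ z 0 → z 0 ≤ A → dist (E4.spatial z) c ≤ A + 2 → z ∈ U) :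
    coneSet A c ⊆ U := by
  rintro _ ⟨⟨t, y⟩, ⟨⟨ht1, ht2⟩, hy⟩, rfl⟩
  exact hU _ (by simpa using ht1) (by simpa using ht2) (by simpa using hy)

/-- **The weight decreases along the energy flow on the slab `{0 ≤ t ≤ T}`**: there the slab
cutoff is identically `1` near the point, and the flux through the cone boundary has a sign on
every background (`Kerr.coneFactor_flux`: the coordinate cones contain the light cones of
`g = η + φ ℓ ⊗ ℓ`, `φ ≥ 0`, and the dominant energy condition). Hawking–Ellis 1973, §4.3,
Lemma 4.3.1. [cite: HawkingEllis1973CUP, §4.3 Lemma 4.3.1] -/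
theorem coneWeight_flux (B : Background) (w : E4 → ℝ) {T A : ℝ} (hTA : T < A) (c : E3) {x : E4}
    (hx0 : 0 ≤ x 0) (hxT : x 0 ≤ T) :
    ∑ μ, fderiv ℝ (coneWeight T A c) x (E4.basisVector μ) *
      normalCurrent B.inverseMetric w x μ ≤ 0 := by
  have hev : coneWeight T A c =ᶠ[𝓝 x] fun y ↦ Real.smoothTransition (Kerr.coneFn A c y) := by
    filter_upwards [Kerr.timeSlabCutoff_eventuallyEq_one hTA hx0 hxT] with y hy
    simp only [coneWeight]
    rw [show Kerr.timeSlabCutoff T A (y 0) = 1 from hy, one_mul]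
  rw [hev.fderiv_eq]
  exact Kerr.coneFactor_flux B w c (lt_of_le_of_lt hxT hTA)

/-! ### Domain of dependence on a background (pointwise form) -/

/-- **Domain of dependence, forward in time (pointwise form, proved by the energy method).** Let
`B` be a generalised Kerr–Schild background, `u` a function `C²` at the points of a set `U ⊆ ℝ⁴`
solving `∑_μ ∂_μ(g^{μν} ∂_ν u) = 0` there, and `x` a point with `0 ≤ x⁰ < R` such that `U`
contains every `z` with `−2 ≤ z⁰ ≤ R` and `dist(z⃗, x⃗) ≤ R + 2`. If the Cauchy data `(u, du)`
vanish at the points `(0, y)` with `dist(y, x⃗) < R`, then `u(x) = 0` and `du(x) = 0`. (The ball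
contains the base `{‖y − x⃗‖ ≤ x⁰}` of the backward coordinate cone of `x`, which contains
`J⁻(x) ∩ {t = 0}` since the light cones of `g` lie inside the coordinate cones.) Proof:
Hawking–Ellis's conservation theorem in the weighted form
`KerrSchild.Background.fderiv_eq_zero_of_weight` (`KerrSchildLocalEnergy.lean`) with the weight
`coneWeight x⁰ ((x⁰ + R)/2) x⃗`, giving `du = 0` along the segment `[0, x⁰] × {x⃗}`, and
integration along it. Hawking–Ellis 1973, §4.3; this is the chart form of
`supp u ⊂ J(supp u₀ ∪ supp u₁)` (Bär–Ginoux–Pfäffle 2007, Thm. 3.2.11) to the future of the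
initial slice. [cite: HawkingEllis1973CUP, §4.3 (Lemma 4.3.1 and the conservation theorem); BarGinouxPfaffle2007, Thm. 3.2.11] -/
theorem eq_zero_of_data_ball (B : Background) {U : Set E4} {u : E4 → ℝ}
    (hu : ∀ z ∈ U, ContDiffAt ℝ 2 u z) (hsol : ∀ z ∈ U, waveOperator B.inverseMetric u z = 0)
    {x : E4} (hx0 : 0 ≤ x 0) {R : ℝ} (hR : x 0 < R)
    (hU : ∀ z : E4, -2 ≤ z 0 → z 0 ≤ R → dist (E4.spatial z) (E4.spatial x) ≤ R + 2 → z ∈ U)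
    (hdata : ∀ y : E3, dist y (E4.spatial x) < R →
      u (E4.ofTimeSpace 0 y) = 0 ∧ fderiv ℝ u (E4.ofTimeSpace 0 y) = 0) :
    u x = 0 ∧ fderiv ℝ u x = 0 := by
  -- ### constants
  set T : ℝ := x 0 with hT
  set c : E3 := E4.spatial x with hc
  set A : ℝ := (T + R) / 2 with hA
  have hTA : T < A := by rw [hA]; linarith
  have hAR : A < R := by rw [hA]; linarith
  -- ### the weight, its support and the hypotheses of the conservation theorem
  set W : E4 → ℝ := coneWeight T A c with hW
  set K : Set E4 := coneSet A c with hK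
  have hKc : IsCompact K := isCompact_coneSet A c
  have hKU : K ⊆ U :=
    coneSet_subset fun z h1 h2 h3 ↦ hU z h1 (h2.trans hAR.le) (h3.trans (by linarith))
  have hWK : ∀ z, W z ≠ 0 → z ∈ K := fun z hz ↦ mem_coneSet_of_coneWeight_ne_zero hTA hz
  have hW1 : ContDiff ℝ 1 W := contDiff_coneWeight T A c
  have hW0 : ∀ z, 0 ≤ W z := coneWeight_nonneg T A c
  have hsolK : ∀ z ∈ K, waveOperator B.inverseMetric u z = 0 := fun z hz ↦ hsol z (hKU hz)
  have hflux : ∀ z ∈ K, 0 ≤ z 0 → z 0 ≤ T →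
      ∑ μ, fderiv ℝ W z (E4.basisVector μ) * normalCurrent B.inverseMetric u z μ ≤ 0 :=
    fun z _ hz0 hzT ↦ B.coneWeight_flux u hTA c hz0 hzT
  have hdataW : ∀ z, z 0 = 0 → W z ≠ 0 → fderiv ℝ u z = 0 := by
    intro z hz0 hWz
    obtain ⟨-, hcone⟩ := mem_of_coneWeight_ne_zero hTA hWz
    have hdist : dist (E4.spatial z) c < R := by
      rw [dist_eq_norm]
      rw [hz0, sub_zero] at hcone
      linarith
    have h := (hdata (E4.spatial z) hdist).2
    rwa [Kerr.ofTimeSpace_spatial_eq hz0] at h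
  -- ### the segment `t ↦ (t, c)`, `t ∈ [0, T]`, lies in `{W ≠ 0}`
  have hWseg : ∀ t ∈ Icc (0 : ℝ) T, W (E4.ofTimeSpace t c) ≠ 0 := by
    intro t ht
    have h1 : Kerr.timeSlabCutoff T A ((E4.ofTimeSpace t c) 0) = 1 := by
      rw [E4.ofTimeSpace_apply_zero]
      exact Kerr.timeSlabCutoff_eq_one hTA (by linarith [ht.1])
        (by linarith [ht.2, sub_pos.mpr hTA])
    have h2 : 0 < Real.smoothTransition (Kerr.coneFn A c (E4.ofTimeSpace t c)) := by
      refine Real.smoothTransition.pos_of_pos ?_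
      have hAt : 0 < A - t := by linarith [ht.2]
      have : Kerr.coneFn A c (E4.ofTimeSpace t c) = (A - t) ^ 2 := by simp [Kerr.coneFn]
      rw [this]
      positivity
    simp only [hW, coneWeight, h1, one_mul]
    exact h2.ne'
  -- ### the conservation theorem along the segment
  have hdseg : ∀ t ∈ Icc (0 : ℝ) T, fderiv ℝ u (E4.ofTimeSpace t c) = 0 := fun t ht ↦
    B.fderiv_eq_zero_of_weight hKc hKU hu hW1 hW0 hWK hsolK hflux hdataW
      (x := E4.ofTimeSpace t c) (by simpa using ht.1) (by simpa using ht.2) (hWseg t ht)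
  -- ### `u(x) = u(0, c) = 0` by integration along the segment
  have hseg_mem : ∀ t ∈ Icc (0 : ℝ) T, E4.ofTimeSpace t c ∈ U := fun t ht ↦
    hKU (hWK _ (hWseg t ht))
  have hud : ∀ t ∈ Icc (0 : ℝ) T, DifferentiableAt ℝ u (E4.ofTimeSpace t c) := fun t ht ↦
    (hu _ (hseg_mem t ht)).differentiableAt (by simp)
  have hx_eq : E4.ofTimeSpace T c = x := E4.ofTimeSpace_time_spatial _
  have hconst : ∀ t ∈ Icc (0 : ℝ) T, u (E4.ofTimeSpace t c) = u (E4.ofTimeSpace 0 c) := by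
    refine constant_of_has_deriv_right_zero (f := fun t ↦ u (E4.ofTimeSpace t c)) ?_ ?_
    · exact fun t ht ↦ (ContinuousAt.comp (f := fun s : ℝ ↦ E4.ofTimeSpace s c) (x := t)
        (hud t ht).continuousAt (E4.hasDerivAt_ofTimeSpace_left t c).continuousAt).continuousWithinAt
    · intro t ht
      have h := (hud t (Ico_subset_Icc_self ht)).hasFDerivAt.comp_hasDerivAt t
        (E4.hasDerivAt_ofTimeSpace_left t c)
      rw [hdseg t (Ico_subset_Icc_self ht), zero_apply] at h
      exact h.hasDerivWithinAt
  have h0c : u (E4.ofTimeSpace 0 c) = 0 := (hdata c (by rw [dist_self]; linarith)).1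
  refine ⟨?_, ?_⟩
  · rw [← hx_eq, hconst T ⟨hx0, le_rfl⟩, h0c]
  · rw [← hx_eq]
    exact hdseg T ⟨hx0, le_rfl⟩

/-- **Domain of dependence, backward in time**, from the forward statement applied to the
time-reversed background `B.timeReverse` and `u ∘ J`. [cite: HawkingEllis1973CUP, §4.3] -/
theorem eq_zero_of_data_ball_of_nonpos (B : Background) {U : Set E4} {u : E4 → ℝ}
    (hu : ∀ z ∈ U, ContDiffAt ℝ 2 u z) (hsol : ∀ z ∈ U, waveOperator B.inverseMetric u z = 0)
    {x : E4} (hx0 : x 0 ≤ 0) {R : ℝ} (hR : -x 0 < R)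
    (hU : ∀ z : E4, -R ≤ z 0 → z 0 ≤ 2 → dist (E4.spatial z) (E4.spatial x) ≤ R + 2 → z ∈ U)
    (hdata : ∀ y : E3, dist y (E4.spatial x) < R →
      u (E4.ofTimeSpace 0 y) = 0 ∧ fderiv ℝ u (E4.ofTimeSpace 0 y) = 0) :
    u x = 0 ∧ fderiv ℝ u x = 0 := by
  set U' : Set E4 := timeReflect ⁻¹' U with hU'
  have hu' : ∀ z ∈ U', ContDiffAt ℝ 2 (u ∘ timeReflect) z := fun z hz ↦
    (hu _ hz).comp z (timeReflect : E4 ≃L[ℝ] E4).contDiff.contDiffAt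
  have hsol' : ∀ z ∈ U', waveOperator B.timeReverse.inverseMetric (u ∘ timeReflect) z = 0 :=
    fun z hz ↦ by rw [B.waveOperator_timeReverse]; exact hsol _ hz
  have hx0' : 0 ≤ timeReflect x 0 := by rw [timeReflect_apply_zero]; linarith
  have hR' : timeReflect x 0 < R := by rwa [timeReflect_apply_zero]
  have hUU : ∀ z : E4, -2 ≤ z 0 → z 0 ≤ R →
      dist (E4.spatial z) (E4.spatial (timeReflect x)) ≤ R + 2 → z ∈ U' := by
    intro z h1 h2 h3
    rw [spatial_timeReflect] at h3
    show timeReflect z ∈ U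
    refine hU _ ?_ ?_ ?_
    · rw [timeReflect_apply_zero]; linarith
    · rw [timeReflect_apply_zero]; linarith
    · rwa [spatial_timeReflect]
  have hdata' : ∀ y : E3, dist y (E4.spatial (timeReflect x)) < R →
      (u ∘ timeReflect) (E4.ofTimeSpace 0 y) = 0 ∧
        fderiv ℝ (u ∘ timeReflect) (E4.ofTimeSpace 0 y) = 0 := by
    intro y hy
    rw [spatial_timeReflect] at hy
    obtain ⟨h0, h1⟩ := hdata y hy
    refine ⟨?_, ?_⟩
    · rw [Function.comp_apply, timeReflect_ofTimeSpace, neg_zero]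
      exact h0
    · rw [fderiv_comp_timeReflect, timeReflect_ofTimeSpace, neg_zero, h1,
        ContinuousLinearMap.zero_comp]
  obtain ⟨h0, h1⟩ := B.timeReverse.eq_zero_of_data_ball hu' hsol' hx0' hR' hUU hdata'
  rw [Function.comp_apply, timeReflect_timeReflect] at h0
  refine ⟨h0, ?_⟩
  rw [fderiv_comp_timeReflect, timeReflect_timeReflect] at h1
  have : fderiv ℝ u x = ((fderiv ℝ u x).comp (timeReflect : E4 →L[ℝ] E4)).comp
      (timeReflect : E4 →L[ℝ] E4) := by
    ext v
    simp
  rw [this, h1, ContinuousLinearMap.zero_comp]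

/-- **Domain of dependence of the initial slice (pointwise form, both time directions).** Let `u`
be `C²` at the points of `U ⊆ ℝ⁴` and solve `∑_μ ∂_μ(g^{μν} ∂_ν u) = 0` there, `|x⁰| < R`, and let
`U` contain every `z` with `|z⁰| ≤ R + 2` and `dist(z⃗, x⃗) ≤ R + 2`. If `(u, du)` vanish at the
points `(0, y)` with `dist(y, x⃗) < R`, then `u(x) = 0` and `du(x) = 0`.
[cite: HawkingEllis1973CUP, §4.3; BarGinouxPfaffle2007, Thm. 3.2.11] -/
theorem eq_zero_of_data_ball_abs (B : Background) {U : Set E4} {u : E4 → ℝ}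
    (hu : ∀ z ∈ U, ContDiffAt ℝ 2 u z) (hsol : ∀ z ∈ U, waveOperator B.inverseMetric u z = 0)
    {x : E4} {R : ℝ} (hR : |x 0| < R)
    (hU : ∀ z : E4, |z 0| ≤ R + 2 → dist (E4.spatial z) (E4.spatial x) ≤ R + 2 → z ∈ U)
    (hdata : ∀ y : E3, dist y (E4.spatial x) < R →
      u (E4.ofTimeSpace 0 y) = 0 ∧ fderiv ℝ u (E4.ofTimeSpace 0 y) = 0) :
    u x = 0 ∧ fderiv ℝ u x = 0 := by
  have hR0 : 0 ≤ R := (abs_nonneg _).trans hR.le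
  rcases le_total 0 (x 0) with hx0 | hx0
  · refine B.eq_zero_of_data_ball hu hsol hx0 (by rwa [abs_of_nonneg hx0] at hR)
      (fun z h1 h2 h3 ↦ hU z ?_ h3) hdata
    rw [abs_le]; constructor <;> linarith
  · refine B.eq_zero_of_data_ball_of_nonpos hu hsol hx0 (by rwa [abs_of_nonpos hx0] at hR)
      (fun z h1 h2 h3 ↦ hU z ?_ h3) hdata
    rw [abs_le]; constructor <;> linarith

/-! ### From coordinate Cauchy data to the full differential on the initial slice -/

/-- **If `w` vanishes on the slice `{t = 0}` near `(0, y)` and `∂_t w(0, y) = 0`, then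
`dw(0, y) = 0`** (the spatial derivatives are derivatives of `w(0, ·) ≡ 0`). [folklore] -/
theorem _root_.Literature.Geometry.Lorentzian.E4.fderiv_eq_zero_of_slice {w : E4 → ℝ} {y : E3}
    (hw : DifferentiableAt ℝ w (E4.ofTimeSpace 0 y))
    (h0 : ∀ᶠ y' in 𝓝 y, w (E4.ofTimeSpace 0 y') = 0)
    (h1 : fderiv ℝ w (E4.ofTimeSpace 0 y) (E4.basisVector 0) = 0) :
    fderiv ℝ w (E4.ofTimeSpace 0 y) = 0 := by
  have h0' : (fun y' ↦ w (E4.ofTimeSpace 0 y')) =ᶠ[𝓝 y] fun _ ↦ (0 : ℝ) := h0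
  have hsp : ∀ i : Fin 3, fderiv ℝ w (E4.ofTimeSpace 0 y) (E4.basisVector i.succ) = 0 := by
    intro i
    rw [← E4.fderiv_comp_ofTimeSpace hw i, h0'.fderiv_eq]
    simp
  ext v
  rw [Kerr.eq_sum_basisVector v, map_sum, zero_apply]
  refine Finset.sum_eq_zero fun μ _ ↦ ?_
  rw [map_smul, smul_eq_mul]
  refine mul_eq_zero_of_right _ ?_
  exact Fin.cases h1 (fun i ↦ hsp i) μ

/-! ### Uniqueness for the Cauchy problem on a slab -/

/-- **Uniqueness on a time slab, with a margin** (auxiliary form of `eq_of_data_eq`: the margin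
`2` is the lower edge of the slab cutoff `Kerr.timeSlabCutoff` and is removed by a dilation
below). Two functions `C²` on the open slab `{|t| < S}` solving `∑_μ ∂_μ(g^{μν} ∂_ν ·) = 0` there
with the same coordinate Cauchy data `(u, ∂_t u)` on `{t = 0}` coincide at every point with
`|x⁰| + 2 < S` (the domain of dependence applied to the difference, whose data vanish
identically). [cite: BarGinouxPfaffle2007, Cor. 3.2.4; HawkingEllis1973CUP, §4.3] -/
theorem eq_of_data_eq_of_lt (B : Background) {S : ℝ} {u v : E4 → ℝ}
    (hu : ∀ z : E4, |z 0| < S → ContDiffAt ℝ 2 u z) (hv : ∀ z : E4, |z 0| < S → ContDiffAt ℝ 2 v z)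
    (hsolu : ∀ z : E4, |z 0| < S → waveOperator B.inverseMetric u z = 0)
    (hsolv : ∀ z : E4, |z 0| < S → waveOperator B.inverseMetric v z = 0)
    (h0 : ∀ y : E3, u (E4.ofTimeSpace 0 y) = v (E4.ofTimeSpace 0 y))
    (h1 : ∀ y : E3, fderiv ℝ u (E4.ofTimeSpace 0 y) (E4.basisVector 0) =
      fderiv ℝ v (E4.ofTimeSpace 0 y) (E4.basisVector 0))
    {x : E4} (hx : |x 0| + 2 < S) : u x = v x := by
  have hS : 0 < S := by linarith [abs_nonneg (x 0)]
  set w : E4 → ℝ := u - v with hw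
  have hwc : ∀ z : E4, |z 0| < S → ContDiffAt ℝ 2 w z := fun z hz ↦ (hu z hz).sub (hv z hz)
  have hG : ∀ (z : E4) (μ ν : Fin 4), DifferentiableAt ℝ (fun y ↦ B.inverseMetric y μ ν) z :=
    fun z μ ν ↦ ((B.contDiff_inverseMetric μ ν).differentiable (by simp)) z
  have hsolw : ∀ z : E4, |z 0| < S → waveOperator B.inverseMetric w z = 0 := fun z hz ↦ by
    rw [hw, waveOperator_sub (hG z) (hu z hz) (hv z hz), hsolu z hz, hsolv z hz, sub_zero]
  have hslice : ∀ y : E3, |(E4.ofTimeSpace 0 y) 0| < S := fun y ↦ by simpa using hS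
  have hdata : ∀ y : E3, w (E4.ofTimeSpace 0 y) = 0 ∧ fderiv ℝ w (E4.ofTimeSpace 0 y) = 0 := by
    intro y
    have hw0 : ∀ y' : E3, w (E4.ofTimeSpace 0 y') = 0 := fun y' ↦ by
      simp only [hw, Pi.sub_apply, h0 y', sub_self]
    refine ⟨hw0 y, E4.fderiv_eq_zero_of_slice ((hwc _ (hslice y)).differentiableAt (by simp))
      (Eventually.of_forall hw0) ?_⟩
    have hud : DifferentiableAt ℝ u (E4.ofTimeSpace 0 y) :=
      (hu _ (hslice y)).differentiableAt (by simp)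
    have hvd : DifferentiableAt ℝ v (E4.ofTimeSpace 0 y) :=
      (hv _ (hslice y)).differentiableAt (by simp)
    rw [hw, fderiv_sub hud hvd, sub_apply, h1 y, sub_self]
  set R : ℝ := (|x 0| + (S - 2)) / 2 with hR
  have hxR : |x 0| < R := by rw [hR]; linarith
  have hRS : R + 2 < S := by rw [hR]; linarith
  have h := B.eq_zero_of_data_ball_abs (U := {z : E4 | |z 0| < S}) (fun z hz ↦ hwc z hz)
    (fun z hz ↦ hsolw z hz) hxR (fun z hz _ ↦ lt_of_le_of_lt hz hRS) (fun y _ ↦ hdata y)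
  have : w x = 0 := h.1
  rwa [hw, Pi.sub_apply, sub_eq_zero] at this

/-- **Uniqueness for the Cauchy problem on a time slab.** Two functions which are `C²` on the
open slab `{|t| < S}`, solve `∑_μ ∂_μ(g^{μν} ∂_ν ·) = 0` there and have the same coordinate
Cauchy data `(u, ∂_t u)` on `{t = 0}` coincide on the slab. The chart form, for slabs of a
generalised Kerr–Schild background over `ℝ⁴`, of Bär–Ginoux–Pfäffle 2007, Cor. 3.2.4
(= arXiv:0806.1036, Ch. 3, Sect. 2, Cor. 2.4: a solution of a normally hyperbolic equation on a
globally hyperbolic manifold with vanishing Cauchy data and source vanishes), proved by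
Hawking–Ellis's energy argument (1973, §4.3) in the form `eq_of_data_eq_of_lt`, whose margin is
removed by the dilation `(t, y) ↦ (λt, λy)` with `0 < λ`, `|x⁰| + 2λ < S` (`Background.dilate`,
`waveOperator_dilate`). [cite: BarGinouxPfaffle2007, Cor. 3.2.4; HawkingEllis1973CUP, §4.3] -/
theorem eq_of_data_eq (B : Background) {S : ℝ} {u v : E4 → ℝ}
    (hu : ∀ z : E4, |z 0| < S → ContDiffAt ℝ 2 u z) (hv : ∀ z : E4, |z 0| < S → ContDiffAt ℝ 2 v z)
    (hsolu : ∀ z : E4, |z 0| < S → waveOperator B.inverseMetric u z = 0)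
    (hsolv : ∀ z : E4, |z 0| < S → waveOperator B.inverseMetric v z = 0)
    (h0 : ∀ y : E3, u (E4.ofTimeSpace 0 y) = v (E4.ofTimeSpace 0 y))
    (h1 : ∀ y : E3, fderiv ℝ u (E4.ofTimeSpace 0 y) (E4.basisVector 0) =
      fderiv ℝ v (E4.ofTimeSpace 0 y) (E4.basisVector 0))
    {x : E4} (hx : |x 0| < S) : u x = v x := by
  -- the dilation factor
  set c : ℝ := min 1 ((S - |x 0|) / 4) with hc
  have hc0 : 0 < c := lt_min one_pos (by linarith)
  have hc1 : c ≤ 1 := min_le_left _ _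
  have hcS : |x 0| + 2 * c < S := by
    have : c ≤ (S - |x 0|) / 4 := min_le_right _ _
    linarith
  -- the dilated slab `{|t| < S / c}` and the dilated functions
  have hslab : ∀ z : E4, |z 0| < S / c → |(c • z) 0| < S := fun z hz ↦ by
    rw [PiLp.smul_apply, smul_eq_mul, abs_mul, abs_of_pos hc0]
    rwa [lt_div_iff₀' hc0] at hz
  have hsm : ContDiff ℝ 2 fun z : E4 ↦ c • z := contDiff_id.const_smul c
  have hu' : ∀ z : E4, |z 0| < S / c → ContDiffAt ℝ 2 (fun y ↦ u (c • y)) z := fun z hz ↦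
    (hu _ (hslab z hz)).comp z hsm.contDiffAt
  have hv' : ∀ z : E4, |z 0| < S / c → ContDiffAt ℝ 2 (fun y ↦ v (c • y)) z := fun z hz ↦
    (hv _ (hslab z hz)).comp z hsm.contDiffAt
  have hsolu' : ∀ z : E4, |z 0| < S / c →
      waveOperator (B.dilate c).inverseMetric (fun y ↦ u (c • y)) z = 0 := fun z hz ↦ by
    rw [B.waveOperator_dilate, hsolu _ (hslab z hz), mul_zero]
  have hsolv' : ∀ z : E4, |z 0| < S / c →
      waveOperator (B.dilate c).inverseMetric (fun y ↦ v (c • y)) z = 0 := fun z hz ↦ by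
    rw [B.waveOperator_dilate, hsolv _ (hslab z hz), mul_zero]
  have h0' : ∀ y : E3, (fun y ↦ u (c • y)) (E4.ofTimeSpace 0 y) =
      (fun y ↦ v (c • y)) (E4.ofTimeSpace 0 y) := fun y ↦ by
    simp only [E4.smul_ofTimeSpace, mul_zero]
    exact h0 _
  have h1' : ∀ y : E3, fderiv ℝ (fun y ↦ u (c • y)) (E4.ofTimeSpace 0 y) (E4.basisVector 0) =
      fderiv ℝ (fun y ↦ v (c • y)) (E4.ofTimeSpace 0 y) (E4.basisVector 0) := fun y ↦ by
    rw [show (fun y ↦ u (c • y)) = (u <| c • ·) from rfl,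
      show (fun y ↦ v (c • y)) = (v <| c • ·) from rfl, fderiv_comp_smul c, fderiv_comp_smul c,
      smul_apply, smul_apply, E4.smul_ofTimeSpace, mul_zero, h1]
  -- the dilated point
  have hx' : |(c⁻¹ • x) 0| + 2 < S / c := by
    rw [PiLp.smul_apply, smul_eq_mul, abs_mul, abs_of_pos (inv_pos.mpr hc0), lt_div_iff₀' hc0,
      mul_add, ← mul_assoc, mul_inv_cancel₀ hc0.ne', one_mul]
    linarith
  have h := (B.dilate c).eq_of_data_eq_of_lt hu' hv' hsolu' hsolv' h0' h1' hx'
  simpa only [smul_smul, mul_inv_cancel₀ hc0.ne', one_smul] using h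

/-! ### The support clause from a global solution -/

/-- **The domain-of-influence clause of `KerrSchild.waveCauchyProblem` holds for every global
`C²` solution**: if `u ∈ C²(ℝ⁴)` solves `∑_μ ∂_μ(g^{μν} ∂_ν u) = 0` on `ℝ⁴` with coordinate Cauchy
data `(ψ₀, ψ₁)` on `{t = 0}`, then `u(x) = 0` at every `x` with `|x⁰| < dist(x⃗, y)` for all
`y ∈ supp ψ₀ ∪ supp ψ₁` (closed supports): the data vanish, with the full differential of `u`, on
the open ball of radius `dist(x⃗, supp ψ₀ ∪ supp ψ₁) > |x⁰|` about `x⃗` (the distance to a closed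
set of the proper space `ℝ³` is attained), and `eq_zero_of_data_ball_abs` applies with `U = ℝ⁴`.
Bär–Ginoux–Pfäffle 2007, Thm. 3.2.11 (`supp u ⊂ J(K)`), in the chart form of
`KerrSchild.waveCauchyProblem` (the light cones of `g` lie inside the coordinate cones).
[cite: BarGinouxPfaffle2007, Thm. 3.2.11; HawkingEllis1973CUP, §4.3] -/
theorem eq_zero_of_forall_lt_dist (B : Background) {u : E4 → ℝ} (hu : ContDiff ℝ 2 u)
    (hsol : ∀ x, waveOperator B.inverseMetric u x = 0) {ψ₀ ψ₁ : E3 → ℝ}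
    (hdata : ∀ y : E3, u (E4.ofTimeSpace 0 y) = ψ₀ y ∧
      fderiv ℝ u (E4.ofTimeSpace 0 y) (E4.basisVector 0) = ψ₁ y)
    {x : E4} (hx : ∀ y ∈ tsupport ψ₀ ∪ tsupport ψ₁, |x 0| < dist (E4.spatial x) y) :
    u x = 0 := by
  set K : Set E3 := tsupport ψ₀ ∪ tsupport ψ₁ with hK
  have hKc : IsClosed K := (isClosed_tsupport ψ₀).union (isClosed_tsupport ψ₁)
  -- a radius `R > |x⁰|` with `B(x⃗, R) ∩ K = ∅`
  obtain ⟨R, hxR, hRK⟩ : ∃ R : ℝ, |x 0| < R ∧ ∀ y : E3, dist y (E4.spatial x) < R → y ∉ K := by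
    rcases K.eq_empty_or_nonempty with hKe | hKne
    · exact ⟨|x 0| + 1, by linarith, fun y _ ↦ by rw [hKe]; exact notMem_empty y⟩
    · obtain ⟨y₀, hy₀K, hy₀⟩ := hKc.exists_infDist_eq_dist hKne (E4.spatial x)
      refine ⟨infDist (E4.spatial x) K, by rw [hy₀]; exact hx y₀ hy₀K, fun y hy hyK ↦ ?_⟩
      have := infDist_le_dist_of_mem hyK (x := E4.spatial x)
      rw [dist_comm] at hy
      linarith
  -- the data of `u` vanish, with the full differential, on that ball
  have hud : ∀ z, DifferentiableAt ℝ u z := fun z ↦ (hu.differentiable (by simp)) z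
  have hball : IsOpen {y : E3 | dist y (E4.spatial x) < R} := isOpen_lt (continuous_id.dist continuous_const) continuous_const
  have hdata0 : ∀ y : E3, dist y (E4.spatial x) < R →
      u (E4.ofTimeSpace 0 y) = 0 ∧ fderiv ℝ u (E4.ofTimeSpace 0 y) = 0 := by
    intro y hy
    have hy0 : ∀ y', y' ∉ K → u (E4.ofTimeSpace 0 y') = 0 := fun y' hy' ↦ by
      rw [(hdata y').1]
      exact image_eq_zero_of_notMem_tsupport fun h ↦ hy' (Or.inl h)
    refine ⟨hy0 y (hRK y hy), E4.fderiv_eq_zero_of_slice (hud _) ?_ ?_⟩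
    · filter_upwards [hball.mem_nhds hy] with y' hy'
      exact hy0 y' (hRK y' hy')
    · rw [(hdata y).2]
      exact image_eq_zero_of_notMem_tsupport fun h ↦ hRK y hy (Or.inr h)
  exact (B.eq_zero_of_data_ball_abs (U := univ) (fun z _ ↦ hu.contDiffAt) (fun z _ ↦ hsol z) hxR
    (fun z _ _ ↦ mem_univ z) hdata0).1

end Background

/-! ### Assembly of the named fact from slab solutions -/

/-- **Reduction of `KerrSchild.waveCauchyProblem` to the existence of smooth solutions on time
slabs of tame backgrounds.** Suppose that on every *tame* background (`Background.IsTame`) all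
data `ψ₀, ψ₁ ∈ C_c^∞(ℝ³)` admit, for every `T > 0`, a function `u` which is `C^∞` at the points of
the open slab `{|t| < T}`, solves `∑_μ ∂_μ(g^{μν} ∂_ν u) = 0` there, and has the coordinate Cauchy
data `u(0, y) = ψ₀(y)`, `∂_t u(0, y) = ψ₁(y)`. Then `KerrSchild.waveCauchyProblem` holds. Proof:
by uniqueness on slabs (`Background.eq_of_data_eq`) the slab solutions of half-widths `n + 3`,
`n ∈ ℕ`, agree on `{|t| < n + 1}` and glue to a global `C^∞` solution (locality of the operator,
`waveOperator_congr_fun`); its support clause is `Background.eq_zero_of_forall_lt_dist`; the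
passage from tame to arbitrary backgrounds is `waveCauchyProblem_of_tame`
(`KerrSchildWaveCauchyReduction.lean`). This is the standard assembly "local (in time) existence +
uniqueness + finite speed of propagation ⟹ global Cauchy development" (Bär–Ginoux–Pfäffle 2007,
proof of Thm. 3.2.11 from Prop. 3.2.6/Lemmas 3.2.7–3.2.8 and Cor. 3.2.4; Hörmander 1997, §6.3,
p. 108). [cite: BarGinouxPfaffle2007, Thm. 3.2.11 (proof); Hormander1997, §6.3 p. 108] -/
theorem waveCauchyProblem_of_slabSolutions
    (h : ∀ B : Background, B.IsTame → ∀ ψ₀ ψ₁ : E3 → ℝ, ContDiff ℝ ∞ ψ₀ → ContDiff ℝ ∞ ψ₁ →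
      HasCompactSupport ψ₀ → HasCompactSupport ψ₁ → ∀ T : ℝ, 0 < T →
      ∃ u : E4 → ℝ, (∀ x : E4, |x 0| < T → ContDiffAt ℝ ∞ u x) ∧
        (∀ x : E4, |x 0| < T → waveOperator B.inverseMetric u x = 0) ∧
        (∀ y : E3, u (E4.ofTimeSpace 0 y) = ψ₀ y ∧
          fderiv ℝ u (E4.ofTimeSpace 0 y) (E4.basisVector 0) = ψ₁ y)) :
    waveCauchyProblem := by
  refine waveCauchyProblem_of_tame fun B hB ψ₀ ψ₁ hψ₀ hψ₁ hc₀ hc₁ ↦ ?_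
  -- slab solutions of half-width `n + 3`
  choose u hu hsol hdata using
    fun n : ℕ ↦ h B hB ψ₀ ψ₁ hψ₀ hψ₁ hc₀ hc₁ ((n : ℝ) + 3) (by positivity)
  have h2le : ((2 : ℕ∞) : WithTop ℕ∞) ≤ ∞ := WithTop.coe_le_coe.mpr le_top
  -- ### the slab solutions agree where both are inner solutions
  have hagree : ∀ (n m : ℕ) (x : E4), |x 0| < n + 1 → |x 0| < m + 1 → u n x = u m x := by
    intro n m x hxn hxm
    have hS : ∀ z : E4, |z 0| < min (n : ℝ) m + 3 → |z 0| < (n : ℝ) + 3 ∧ |z 0| < (m : ℝ) + 3 :=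
      fun z hz ↦ ⟨lt_of_lt_of_le hz (by linarith [min_le_left (n : ℝ) m]),
        lt_of_lt_of_le hz (by linarith [min_le_right (n : ℝ) m])⟩
    refine B.eq_of_data_eq_of_lt (S := min (n : ℝ) m + 3) (fun z hz ↦ (hu n z (hS z hz).1).of_le h2le)
      (fun z hz ↦ (hu m z (hS z hz).2).of_le h2le) (fun z hz ↦ hsol n z (hS z hz).1)
      (fun z hz ↦ hsol m z (hS z hz).2) (fun y ↦ by rw [(hdata n y).1, (hdata m y).1])
      (fun y ↦ by rw [(hdata n y).2, (hdata m y).2]) ?_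
    rcases le_total (n : ℝ) m with hnm | hnm
    · rw [min_eq_left hnm]; linarith
    · rw [min_eq_right hnm]; linarith
  -- ### the glued function
  set N : E4 → ℕ := fun x ↦ ⌈|x 0|⌉₊ with hN
  have hNx : ∀ x : E4, |x 0| ≤ N x := fun x ↦ Nat.le_ceil _
  set w : E4 → ℝ := fun x ↦ u (N x) x with hw
  -- near every point `x` the glued function is the slab solution of index `N x + 1`
  have hloc : ∀ x : E4, w =ᶠ[𝓝 x] u (N x + 1) := by
    intro x
    have hopen : IsOpen {z : E4 | |z 0| < |x 0| + 1 / 2} :=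
      isOpen_lt (continuous_abs.comp (contDiff_apply_zero (n := 0)).continuous) continuous_const
    filter_upwards [hopen.mem_nhds (show |x 0| < |x 0| + 1 / 2 by linarith)] with z hz
    have hz' : |z 0| < |x 0| + 1 / 2 := hz
    refine hagree (N z) (N x + 1) z (by linarith [hNx z]) ?_
    push_cast
    linarith [hNx x]
  have hin : ∀ x : E4, |x 0| < ((N x + 1 : ℕ) : ℝ) + 3 := fun x ↦ by
    push_cast; linarith [hNx x]
  refine ⟨w, ?_, fun x ↦ ?_, fun y ↦ ?_, fun x hx ↦ ?_⟩
  · exact contDiff_iff_contDiffAt.mpr fun x ↦ (hu (N x + 1) x (hin x)).congr_of_eventuallyEq (hloc x)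
  · rw [waveOperator_congr_fun (hloc x)]
    exact hsol (N x + 1) x (hin x)
  · have hN0 : N (E4.ofTimeSpace 0 y) = 0 := by simp [hN]
    refine ⟨?_, ?_⟩
    · show u (N (E4.ofTimeSpace 0 y)) (E4.ofTimeSpace 0 y) = ψ₀ y
      rw [hN0]
      exact (hdata 0 y).1
    · rw [(hloc _).fderiv_eq, hN0]
      exact (hdata (0 + 1) y).2
  · have hwc : ContDiff ℝ ∞ w :=
      contDiff_iff_contDiffAt.mpr fun x ↦ (hu (N x + 1) x (hin x)).congr_of_eventuallyEq (hloc x)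
    have hsolw : ∀ x, waveOperator B.inverseMetric w x = 0 := fun x ↦ by
      rw [waveOperator_congr_fun (hloc x)]
      exact hsol (N x + 1) x (hin x)
    have hdataw : ∀ y : E3, w (E4.ofTimeSpace 0 y) = ψ₀ y ∧
        fderiv ℝ w (E4.ofTimeSpace 0 y) (E4.basisVector 0) = ψ₁ y := by
      intro y
      have hN0 : N (E4.ofTimeSpace 0 y) = 0 := by simp [hN]
      refine ⟨?_, ?_⟩
      · show u (N (E4.ofTimeSpace 0 y)) (E4.ofTimeSpace 0 y) = ψ₀ y
        rw [hN0]
        exact (hdata 0 y).1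
      · rw [(hloc _).fderiv_eq, hN0]
        exact (hdata (0 + 1) y).2
    exact B.eq_zero_of_forall_lt_dist (hwc.of_le h2le) hsolw hdataw hx

/-- **Reduction of `KerrSchild.waveCauchyProblem` to the existence of global smooth solutions with
prescribed Cauchy data on tame backgrounds** (no support clause): the special case of
`waveCauchyProblem_of_slabSolutions` in which one global solution serves every slab.
[cite: BarGinouxPfaffle2007, Thm. 3.2.11 (proof); Hormander1997, §6.3 p. 108] -/
theorem waveCauchyProblem_of_globalSolutions
    (h : ∀ B : Background, B.IsTame → ∀ ψ₀ ψ₁ : E3 → ℝ, ContDiff ℝ ∞ ψ₀ → ContDiff ℝ ∞ ψ₁ →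
      HasCompactSupport ψ₀ → HasCompactSupport ψ₁ →
      ∃ u : E4 → ℝ, ContDiff ℝ ∞ u ∧ (∀ x : E4, waveOperator B.inverseMetric u x = 0) ∧
        (∀ y : E3, u (E4.ofTimeSpace 0 y) = ψ₀ y ∧
          fderiv ℝ u (E4.ofTimeSpace 0 y) (E4.basisVector 0) = ψ₁ y)) :
    waveCauchyProblem :=
  waveCauchyProblem_of_slabSolutions fun B hB ψ₀ ψ₁ h₀ h₁ c₀ c₁ _ _ ↦ by
    obtain ⟨u, hu, hsol, hdata⟩ := h B hB ψ₀ ψ₁ h₀ h₁ c₀ c₁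
    exact ⟨u, fun x _ ↦ hu.contDiffAt, fun x _ ↦ hsol x, hdata⟩

/-- **Reduction of `KerrSchild.waveCauchyProblem` to slab solutions of every finite order of
regularity** ("regularity by uniqueness across levels"): if on every tame background all
`C_c^∞` data admit, for every `k ∈ ℕ` and every `T > 0`, a solution of class `C^{k+2}` at the points
of the open slab `{|t| < T}` with the data, then the fact holds. Indeed by uniqueness on the slab
(`Background.eq_of_data_eq`, which needs `C²`) the solution of order `2` coincides on the open slab
with the solution of order `k + 2`, for every `k`, so it is `C^∞` there (`contDiffAt_infty`), and
`waveCauchyProblem_of_slabSolutions` applies. This is the form delivered by energy-method existence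
theorems in `H^s` for every `s` (Hörmander 1997, §6.3, Thm. 6.3.2 ff.; Alinhac 2009, Thm. 7.11),
combined with Sobolev embedding. [cite: Hormander1997, §6.3 p. 108; BarGinouxPfaffle2007, Cor. 3.2.4] -/
theorem waveCauchyProblem_of_slabSolutions_nat
    (h : ∀ B : Background, B.IsTame → ∀ ψ₀ ψ₁ : E3 → ℝ, ContDiff ℝ ∞ ψ₀ → ContDiff ℝ ∞ ψ₁ →
      HasCompactSupport ψ₀ → HasCompactSupport ψ₁ → ∀ (k : ℕ) (T : ℝ), 0 < T →
      ∃ u : E4 → ℝ, (∀ x : E4, |x 0| < T → ContDiffAt ℝ (k + 2) u x) ∧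
        (∀ x : E4, |x 0| < T → waveOperator B.inverseMetric u x = 0) ∧
        (∀ y : E3, u (E4.ofTimeSpace 0 y) = ψ₀ y ∧
          fderiv ℝ u (E4.ofTimeSpace 0 y) (E4.basisVector 0) = ψ₁ y)) :
    waveCauchyProblem := by
  refine waveCauchyProblem_of_slabSolutions fun B hB ψ₀ ψ₁ hψ₀ hψ₁ hc₀ hc₁ T hT ↦ ?_
  choose u hu hsol hdata using fun k : ℕ ↦ h B hB ψ₀ ψ₁ hψ₀ hψ₁ hc₀ hc₁ k T hT
  have h2 : ∀ (k : ℕ) (z : E4), |z 0| < T → ContDiffAt ℝ 2 (u k) z := fun k z hz ↦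
    (hu k z hz).of_le (by exact_mod_cast Nat.le_add_left 2 k)
  -- all the slab solutions coincide with the one of order `2` on the open slab
  have hagree : ∀ (k : ℕ) (z : E4), |z 0| < T → u 0 z = u k z := fun k z hz ↦
    B.eq_of_data_eq (h2 0) (h2 k) (hsol 0) (hsol k) (fun y ↦ by rw [(hdata 0 y).1, (hdata k y).1])
      (fun y ↦ by rw [(hdata 0 y).2, (hdata k y).2]) hz
  have hopen : IsOpen {z : E4 | |z 0| < T} :=
    isOpen_lt (continuous_abs.comp (contDiff_apply_zero (n := 0)).continuous) continuous_const
  refine ⟨u 0, fun x hx ↦ ?_, hsol 0, hdata 0⟩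
  rw [contDiffAt_infty]
  intro n
  have hev : u 0 =ᶠ[𝓝 x] u n := by
    filter_upwards [hopen.mem_nhds hx] with z hz
    exact hagree n z hz
  exact ((hu n x hx).of_le (by exact_mod_cast Nat.le_add_right n 2)).congr_of_eventuallyEq hev

end KerrSchild

end Literature.Geometry.Lorentzian

end
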